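import Summits.BirchSwinnertonDyer.BirchSwinnertonDyer.Theorems.ClassRecordThreeEulerHalvesAtThreeOfUB
import Summits.BirchSwinnertonDyer.BirchSwinnertonDyer.Theorems.ClassRecordThreeEulerHalvesAtThreeTwistLowerOfX11a
import Summits.BirchSwinnertonDyer.BirchSwinnertonDyer.Theses.ErratumRoadFive
import HarnessLib

/-!
# Crux `EulerHalvesAtThree` (item stmt-BirchSwinnertonDyer-19109): the stub TL₃ BY NAME from rung K2's
# crux `ErratumRoadFive.X11aLowerHalf` (item 19064) read at `p = 3` + the @3 routes' published-inputs
# item; and the UB road to the crux with TL₃ so replaced (cell `bsd-stepL`, seat `bsd-stepL-mult-p3`,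
# session g0; `--supports stmt-BirchSwinnertonDyer-19109`)

HONEST FRAMING (cell `bsd-stepL`, HOME `run/shared/lean/pub/bsd-stepL/`): by-name wrappers only; nothing
here proves TL₃, UB∃ᴮ@3 or the X11a lower half; item 19109 is NOT closed; nothing is booked or re-labelled
(T7); BSD is proved for no curve. The PUB binder Skinner 2016 Thm. C at `p = 3` (conjunct of the routes'
published-inputs items 19112 ∕ 19156 via 19381) carries the tree flag `SU14-12.3.6-mu@nonsplit@3`.

WHAT THIS FILE RECORDS (the by-name layer over the Theses-free identification
`Koly.twistLowerAtThree_iff_x11aLowerHalfAtThree`, file `…EulerHalvesAtThreeTwistLowerOfX11a.lean`):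
* §1 `x11aLowerHalfAtThree_of_x11aLowerHalf` — rung K2's crux 19064
  `Summit.….Theses.ErratumRoadFive.X11aLowerHalf` (∀ p; rung K6 ∕ B3's (ram)-free rank-`0` lower bound,
  shared by name on route `ErratumRoadFive`) specialises to the `p = 3` shape
  `∀ V, ClassX11a V 3 → Typed.MissingLowerBoundAt V 3`.
* §2 `twistLowerAtThree_of_publishedInputsThree_of_x11aLowerHalf` ∕ `…KolyThree…` — the registered stub
  TL₃ (`stub_twistLowerAtThree`, VERBATIM) of 19109's birth skeleton from the route's OWN published-inputs
  item (`ClassRecordThree.PublishedInputsThree` = K2@3 `closes` binder h₆, resp.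
  `KolyvaginRoadThree.PublishedInputsKolyThree` = KOLY binder h₇; conjuncts used: Skinner Thm C, GZK,
  modularity) + 19064 BY NAME. So TL₃ is NOT an independent open input of the @3 routes: it is item 19064
  (already a crux of the K2 route at every `p`) read at `3`.
* §3 `classRecordThree_eulerHalvesAtThree_of_ubB₃_of_x11aLowerHalf` ∕ KOLY twin — bdp g19's UB road
  (`classRecordThree_eulerHalvesAtThree_of_ubB₃_of_items`, p528882) with its TL₃ binder fed by §2: the
  crux BY NAME ⟸ {h₆ ∕ h₇, thm331_mult (PUB), LZZ (PUB), UB∃ᴮ@3 (sourceless at 3), 19064}.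

References: [Skinner2016PacificMC] Thm. C (§1); [JetchevSkinnerWan2017] Thm. 3.3.1, §7.4.2;
[LiuZhangZhang2018] Thms. 1.5.1, 1.5.3; [Miller2011LMS] Def. 1.1.
-/

set_option autoImplicit false
set_option linter.dupNamespace false

noncomputable section

open scoped Classical NumberField

open WeierstrassCurve NumberField IsDedekindDomain Field PowerSeries
open Literature.NumberTheory.EllipticCurves
open Literature.NumberTheory.EllipticCurves.ModularForms
open Literature.NumberTheory.EllipticCurves.Rank1Residual
open Literature.NumberTheory.EllipticCurves.Rank1Residual.Typed
open Literature.NumberTheory.EllipticCurves.JetchevSkinnerWan2017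
open Literature.NumberTheory.GaloisRepresentations Literature.NumberTheory.GaloisCohomology
open Literature.NumberTheory.Automorphic
open Summit.BirchSwinnertonDyer.Rank1Residual Summit.BirchSwinnertonDyer.Rank1Residual.X11b
open Summit.BirchSwinnertonDyer.Rank1Residual.X11b.AcSelmer
open Summit.BirchSwinnertonDyer.Rank1Residual.X11b.Halves
open Summit.BirchSwinnertonDyer.Rank1Residual.X11b.Three

namespace Summit.BirchSwinnertonDyer.BirchSwinnertonDyer.Theorems.EulerHalfUB

/-! ### §1 Rung K2's crux 19064 read at `p = 3` -/

/-- **`ErratumRoadFive.X11aLowerHalf` (item 19064, every prime) ⟹ the X11a lower half at `3`.**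
One-line specialisation. [cite: Miller2011LMS, Def. 1.1] -/
theorem x11aLowerHalfAtThree_of_x11aLowerHalf
    (hX : Summit.BirchSwinnertonDyer.BirchSwinnertonDyer.Theses.ErratumRoadFive.X11aLowerHalf) :
    ∀ (V : WeierstrassCurve ℚ) [V.IsElliptic] [V.IsGloballyMinimal],
      ClassX11a V 3 → Typed.MissingLowerBoundAt V 3 :=
  fun V _ _ hV ↦ hX V 3 hV

/-! ### §2 TL₃ by name from the route's published-inputs item + 19064 -/

/-- **K2@3: TL₃ (the registered stub `stub_twistLowerAtThree` of 19109, VERBATIM) ⟸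
`ClassRecordThree.PublishedInputsThree` (item 19112; conjuncts Skinner Thm C ∕ GZK ∕ modularity) +
`ErratumRoadFive.X11aLowerHalf` (item 19064) BY NAME.** Via `Koly.twistLowerAtThree_of_thmC_of_x11aLowerHalfAtThree`.
CONDITIONAL on the binders; nothing booked. [cite: Skinner2016PacificMC, Thm. C (§1)]
[cite: Miller2011LMS, Def. 1.1] -/
theorem twistLowerAtThree_of_publishedInputsThree_of_x11aLowerHalf
    (h₆ : Summit.BirchSwinnertonDyer.BirchSwinnertonDyer.Theses.ClassRecordThree.PublishedInputsThree)
    (hX : Summit.BirchSwinnertonDyer.BirchSwinnertonDyer.Theses.ErratumRoadFive.X11aLowerHalf) :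
    ∀ (V : WeierstrassCurve ℚ) [V.IsElliptic] [V.IsGloballyMinimal],
      V.HasMultiplicativeReductionAtPrime 3 → V.HasIrreducibleModPGaloisRep 3 →
      V.entireLFunction 1 ≠ 0 → Finite V.sha →
      ∃ q : ℚ, V.entireLFunction 1 / (V.realPeriodRat : ℂ) = (q : ℂ) ∧
        padicValRat 3 q ≤ (padicValNat 3 V.shaOrder : ℤ) + padicValNat 3 V.tamagawaProduct -
          2 * padicValNat 3 V.torsionOrder := by
  obtain ⟨-, -, -, hSk, -, hGZK, hmod, -, -, -, -, -, -, -, -, -, -, -, -, -⟩ := h₆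
  exact Koly.twistLowerAtThree_of_thmC_of_x11aLowerHalfAtThree hmod hGZK hSk
    (x11aLowerHalfAtThree_of_x11aLowerHalf hX)

/-- **KOLY: the same from `KolyvaginRoadThree.PublishedInputsKolyThree` (item 19156, binder h₇) + 19064.**
[cite: Skinner2016PacificMC, Thm. C (§1)] [cite: Miller2011LMS, Def. 1.1] -/
theorem twistLowerAtThree_of_publishedInputsKolyThree_of_x11aLowerHalf
    (h₇ : Summit.BirchSwinnertonDyer.BirchSwinnertonDyer.Theses.KolyvaginRoadThree.PublishedInputsKolyThree)
    (hX : Summit.BirchSwinnertonDyer.BirchSwinnertonDyer.Theses.ErratumRoadFive.X11aLowerHalf) :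
    ∀ (V : WeierstrassCurve ℚ) [V.IsElliptic] [V.IsGloballyMinimal],
      V.HasMultiplicativeReductionAtPrime 3 → V.HasIrreducibleModPGaloisRep 3 →
      V.entireLFunction 1 ≠ 0 → Finite V.sha →
      ∃ q : ℚ, V.entireLFunction 1 / (V.realPeriodRat : ℂ) = (q : ℂ) ∧
        padicValRat 3 q ≤ (padicValNat 3 V.shaOrder : ℤ) + padicValNat 3 V.tamagawaProduct -
          2 * padicValNat 3 V.torsionOrder := by
  obtain ⟨⟨-, -, -, hSk, -, hGZK, hmod, -, -, -, -, -, -, -, -, -, -, -, -, -⟩, -, -, -⟩ := h₇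
  exact Koly.twistLowerAtThree_of_thmC_of_x11aLowerHalfAtThree hmod hGZK hSk
    (x11aLowerHalfAtThree_of_x11aLowerHalf hX)

/-- **Conversely (K2@3): TL₃ + `PublishedInputsThree` ⟹ the X11a lower half at `3`** — so on the @3 routes
the two binders are interchangeable given h₆. [cite: Miller2011LMS, Def. 1.1] -/
theorem x11aLowerHalfAtThree_of_publishedInputsThree_of_twistLowerAtThree
    (h₆ : Summit.BirchSwinnertonDyer.BirchSwinnertonDyer.Theses.ClassRecordThree.PublishedInputsThree)
    (hTL : ∀ (V : WeierstrassCurve ℚ) [V.IsElliptic] [V.IsGloballyMinimal],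
      V.HasMultiplicativeReductionAtPrime 3 → V.HasIrreducibleModPGaloisRep 3 →
      V.entireLFunction 1 ≠ 0 → Finite V.sha →
      ∃ q : ℚ, V.entireLFunction 1 / (V.realPeriodRat : ℂ) = (q : ℂ) ∧
        padicValRat 3 q ≤ (padicValNat 3 V.shaOrder : ℤ) + padicValNat 3 V.tamagawaProduct -
          2 * padicValNat 3 V.torsionOrder) :
    ∀ (V : WeierstrassCurve ℚ) [V.IsElliptic] [V.IsGloballyMinimal],
      ClassX11a V 3 → Typed.MissingLowerBoundAt V 3 := by
  obtain ⟨-, -, -, -, -, hGZK, hmod, -, -, -, -, -, -, -, -, -, -, -, -, -⟩ := h₆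
  exact Koly.x11aLowerHalfAtThree_of_twistLowerAtThree hmod hGZK hTL

/-! ### §3 The UB road to the crux with TL₃ replaced by 19064 -/

/-- **K2@3: `ClassRecordThree.EulerHalvesAtThree` BY NAME ⟸ {h₆ = `PublishedInputsThree`, thm331_mult (PUB),
LZZ (PUB), UB∃ᴮ@3 on X11b@3 (inline; SOURCELESS at 3), `ErratumRoadFive.X11aLowerHalf` (19064)}** — bdp g19's
`classRecordThree_eulerHalvesAtThree_of_ubB₃_of_items` with its TL₃ binder fed by §2. CONDITIONAL; item 19109
NOT closed; nothing booked. [cite: JetchevSkinnerWan2017, Thm. 3.3.1 and §7.4.2 (arXiv:1512.06894 pp. 11, 31)]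
[cite: LiuZhangZhang2018, Thm. 1.5.1 and Thm. 1.5.3] [cite: Miller2011LMS, Def. 1.1] -/
theorem classRecordThree_eulerHalvesAtThree_of_ubB₃_of_x11aLowerHalf
    (h₆ : Summit.BirchSwinnertonDyer.BirchSwinnertonDyer.Theses.ClassRecordThree.PublishedInputsThree)
    (h331 : thm331_anticyclotomicControl_mult)
    (hLZZ : LiuZhangZhang2018.thm151_thm153_modularCurve_heegnerVector)
    (hUB : ∀ (W : WeierstrassCurve ℚ) [W.IsElliptic] [W.IsGloballyMinimal], ClassX11b W 3 →
      ∀ (N : ℕ) [NeZero N] (K : Type) [Field K] [NumberField K] (Dt : ModularParametrizationData W N)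
      (H : HeegnerDatum N (NumberField.discr K)) (ι : K →+* ℂ) (P : (W.baseChange K).toAffine.Point),
      ClassX11b W 3 → Surj W 3 → W.conductorNorm ℤ = N → IsImaginaryQuadratic K →
      Odd (NumberField.discr K) → SatisfiesHeegnerHypothesis N K →
      (W.quadraticTwist (NumberField.discr K : ℚ)).entireLFunction 1 ≠ 0 →
      WeierstrassCurve.Affine.Point.map ι.toRatAlgHom P = heegnerPointComplex Dt H →
      ¬ (3 : ℤ) ∣ Dt.c → ¬ IsOfFinAddOrder P →
      ∀ (κ : ZpExtension K 3), κ.IsAnticyclotomic →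
        ∀ (γ : Field.absoluteGaloisGroup K) [Fact (κ.IsTopGenerator γ)]
          (𝔭 : HeightOneSpectrum (𝓞 K)), ((3 : ℕ) : 𝓞 K) ∈ 𝔭.asIdeal →
          𝔭.asIdeal.ramificationIdx (𝓞 ℚ) = 1 → 𝔭.asIdeal.inertiaDeg (𝓞 ℚ) = 1 →
          ∀ (f : CuspForm (CongruenceSubgroup.Gamma0 N) 2), IsNewformOf W f →
            ∃ ι' : PadicAlgCl 3 ≃+* ℂ, InducesPrime ι' 𝔭 ∧
              ∃ (ΩK : ℂ) (Ωp : (unrIntegers 3)ˣ) (L : UnrSeries 3),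
                ΩK ≠ 0 ∧ IsBDPLFunction ι' 𝔭 κ γ f ΩK ((Ωp : unrIntegers 3) : ℂ_[3]) L ∧
                ∀ (𝔭bar : HeightOneSpectrum (𝓞 K)), ((3 : ℕ) : 𝓞 K) ∈ 𝔭bar.asIdeal → 𝔭bar ≠ 𝔭 →
                  Ideal.span {L} ≤
                    (XAc.charIdeal (W.baseChange K) 3 κ 𝔭bar ∅ γ).map (PowerSeries.map (toUnr 3)))
    (hX : Summit.BirchSwinnertonDyer.BirchSwinnertonDyer.Theses.ErratumRoadFive.X11aLowerHalf) :
    Summit.BirchSwinnertonDyer.BirchSwinnertonDyer.Theses.ClassRecordThree.EulerHalvesAtThree :=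
  classRecordThree_eulerHalvesAtThree_of_ubB₃_of_items h₆ h331 hLZZ hUB
    (twistLowerAtThree_of_publishedInputsThree_of_x11aLowerHalf h₆ hX)

/-- **KOLY: `KolyvaginRoadThree.EulerHalvesAtThree` BY NAME ⟸ {h₇ = `PublishedInputsKolyThree`, thm331_mult, LZZ,
UB∃ᴮ@3, 19064}.** [cite: JetchevSkinnerWan2017, Thm. 3.3.1 and §7.4.2] [cite: LiuZhangZhang2018, Thm. 1.5.1 and Thm. 1.5.3]
[cite: Miller2011LMS, Def. 1.1] -/
theorem kolyvaginRoadThree_eulerHalvesAtThree_of_ubB₃_of_x11aLowerHalf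
    (h₇ : Summit.BirchSwinnertonDyer.BirchSwinnertonDyer.Theses.KolyvaginRoadThree.PublishedInputsKolyThree)
    (h331 : thm331_anticyclotomicControl_mult)
    (hLZZ : LiuZhangZhang2018.thm151_thm153_modularCurve_heegnerVector)
    (hUB : ∀ (W : WeierstrassCurve ℚ) [W.IsElliptic] [W.IsGloballyMinimal], ClassX11b W 3 →
      ∀ (N : ℕ) [NeZero N] (K : Type) [Field K] [NumberField K] (Dt : ModularParametrizationData W N)
      (H : HeegnerDatum N (NumberField.discr K)) (ι : K →+* ℂ) (P : (W.baseChange K).toAffine.Point),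
      ClassX11b W 3 → Surj W 3 → W.conductorNorm ℤ = N → IsImaginaryQuadratic K →
      Odd (NumberField.discr K) → SatisfiesHeegnerHypothesis N K →
      (W.quadraticTwist (NumberField.discr K : ℚ)).entireLFunction 1 ≠ 0 →
      WeierstrassCurve.Affine.Point.map ι.toRatAlgHom P = heegnerPointComplex Dt H →
      ¬ (3 : ℤ) ∣ Dt.c → ¬ IsOfFinAddOrder P →
      ∀ (κ : ZpExtension K 3), κ.IsAnticyclotomic →
        ∀ (γ : Field.absoluteGaloisGroup K) [Fact (κ.IsTopGenerator γ)]
          (𝔭 : HeightOneSpectrum (𝓞 K)), ((3 : ℕ) : 𝓞 K) ∈ 𝔭.asIdeal →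
          𝔭.asIdeal.ramificationIdx (𝓞 ℚ) = 1 → 𝔭.asIdeal.inertiaDeg (𝓞 ℚ) = 1 →
          ∀ (f : CuspForm (CongruenceSubgroup.Gamma0 N) 2), IsNewformOf W f →
            ∃ ι' : PadicAlgCl 3 ≃+* ℂ, InducesPrime ι' 𝔭 ∧
              ∃ (ΩK : ℂ) (Ωp : (unrIntegers 3)ˣ) (L : UnrSeries 3),
                ΩK ≠ 0 ∧ IsBDPLFunction ι' 𝔭 κ γ f ΩK ((Ωp : unrIntegers 3) : ℂ_[3]) L ∧
                ∀ (𝔭bar : HeightOneSpectrum (𝓞 K)), ((3 : ℕ) : 𝓞 K) ∈ 𝔭bar.asIdeal → 𝔭bar ≠ 𝔭 →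
                  Ideal.span {L} ≤
                    (XAc.charIdeal (W.baseChange K) 3 κ 𝔭bar ∅ γ).map (PowerSeries.map (toUnr 3)))
    (hX : Summit.BirchSwinnertonDyer.BirchSwinnertonDyer.Theses.ErratumRoadFive.X11aLowerHalf) :
    Summit.BirchSwinnertonDyer.BirchSwinnertonDyer.Theses.KolyvaginRoadThree.EulerHalvesAtThree :=
  kolyvaginRoadThree_eulerHalvesAtThree_of_ubB₃_of_items h₇ h331 hLZZ hUB
    (twistLowerAtThree_of_publishedInputsKolyThree_of_x11aLowerHalf h₇ hX)

end Summit.BirchSwinnertonDyer.BirchSwinnertonDyer.Theorems.EulerHalfUB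

end
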